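import Summits.Ventures.YMGap.Thresholds.ZeroCouplingKernelAllGroups
import Summits.Ventures.YMGap.Thresholds.StrongCouplingAnalytic
import Literature.MathematicalPhysics.QuantumFieldTheory.LatticeGaugeShenZhuZhuProofs
import Literature.Probability.LatticeModels.GibbsStrongMarkov
import HarnessLib

/-!
# The first strong-coupling coefficient for EVERY gauge group, uniformly over ALL DLR states; the second-order jet of the
# free energy density at `β = 0` (row type C-SLOPE-0-G, part 2 of 2)

Cell `pub-ymgap`, seat ds-1 (gen 15). HONEST FRAMING: exact LATTICE statements at the strong-coupling END POINT `β = 0`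
of the Wilson action `β Σ_p (N − Re tr ρ(U_p))` on `ℤ^d`, for an ARBITRARY compact metrisable gauge group `G`, an
arbitrary continuous finite-dimensional representation `ρ`, every `d`, both signs of `β`. The content is an exact
first-order coefficient with an explicit `O(β²)` remainder that is UNIFORM OVER ALL DLR STATES (no uniqueness, no window,
no cluster expansion, no selection); its size is generality and exactness, not a threshold. Nothing about weak coupling,
the continuum, or the Clay problem. Kernel theorems only, 0 definitions, 0 compute.

## Contents

3. ★★ **Uniform first-order expansion** (`abs_integral_plaquette_sub_taylor_le`, `exists_forall_abs_integral_plaquette_sub_le`):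
   for every continuous `φ : G → ℝ`, every plaquette `p`, EVERY `β ∈ ℝ` and EVERY DLR state `ν ∈ 𝒢(β)`,
   `|∫ φ(U_p) dν − ∫ φ dHaar − β · Cov_Haar(φ, Re tr ρ)| ≤ K β²`, `K` independent of `β` and `ν` — the DLR equation at the
   four links of `p` (the Literature's `setIntegral_integral_spec`) and part 1 (`η`-uniform second-order expansion of the tilted
   kernel with boundary-independent coefficients). Hence ★ `hasDerivAt_integral_plaquette_zero` (along ANY family of DLR
   states the expectation of `φ(U_p)` is differentiable at `0` with derivative `Cov_Haar(φ, Re tr ρ)`), ★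
   `hasDerivAt_plaquetteObs_zero` (the slope of the mean plaquette is the Haar VARIANCE of `Re tr ρ`), the first-order
   selection rule `exists_forall_abs_integral_plaquette_sub_le_of_cov_eq_zero`, and `integral_plaquette_eq_of_mem_zero`.
4. ★★ **The second-order jet of the free energy density at `β = 0`, every `G`** (`hasDerivAt_freeEnergyDensity_zero`,
   `hasDerivAt_deriv_freeEnergyDensity_zero`): `f'(0) = −#planes · (N − ∫ Re tr ρ dHaar)`, `f''(0) = #planes · Var_Haar(Re tr ρ) ≥ 0`
   (`#planes = card {i < j}`), TWO-SIDED — gen 13's analytic torus-limit DLR selection, gen 9's energy-subgradient chord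
   `f' = −e(ν_β)`, and item 3 plane by plane.
5. Rows, `G ≅ SU(N)` fundamental (`IsSpecialUnitaryModel ρ`): slope `charVariance ρ`, `f'(0) = −N · #planes`,
   `f''(0) = #planes · charVariance ρ`; `d = 4`: `SU(2)` `(−12, 6)` (the tree's gen-9 values, re-derived from the every-`G`
   theorem), `SU(N ≥ 3)` `(−6N, 3)` (rb-p2's `HaarSecondMoments`).

References (mechanism): R. L. Dobrushin, Theory Probab. Appl. 13 (1968) 197 and H.-O. Georgii, *Gibbs Measures and Phase
Transitions* (2011) Rem. 1.24 (DLR equations); B. Simon, *The Statistical Mechanics of Lattice Gases* I (1993) §II.1;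
R. Balian, J.-M. Drouffe, C. Itzykson, PRD 11 (1975) 2104 (strong-coupling series, first coefficients); S. Friedli,
Y. Velenik, *Statistical Mechanics of Lattice Systems* (2017) Prop. 6.91 (energy subgradients of the pressure).
-/

noncomputable section

open MeasureTheory ProbabilityTheory Set Filter Topology Finset
open scoped NNReal
open Literature.Probability.LatticeModels (glueWith IsGibbsMeasure IsSpecification measurable_glueWith)
open Literature.MathematicalPhysics.QuantumLattice (LGConfig ZdEdge ZdPlaquette fundamentalRep ymGibbsMeasures
  ymSpecification plaquetteObs plaquetteEdges plaquettesTouching plaquetteHolonomyZd wilsonBoundaryAction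
  freeEnergyDensity IsZdTranslationInvariant continuous_plaquetteObs continuous_wilsonBoundaryAction)
open Literature.MathematicalPhysics.QuantumFieldTheory hiding ZdEdge
open Literature.MathematicalPhysics.QuantumFieldTheory.PlaquetteLowerBound (reTr charVariance integral_reTr_eq_zero
  continuous_reTr)

namespace Summit.Ventures.YMGap.ZeroCouplingSlope

/-! ## 3. The uniform first-order expansion over all DLR states -/

section Expansion

variable {d N : ℕ} {G : Type*} [Group G] [TopologicalSpace G] [IsTopologicalGroup G] [CompactSpace G]
  [MeasurableSpace G] [BorelSpace G] [SecondCountableTopology G] [T2Space G] (ρ : G →* Matrix (Fin N) (Fin N) ℂ)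

/-- ★★ **Uniform first-order strong-coupling expansion of a plaquette observable — every compact gauge group, every DLR
state, explicit constant.** For continuous `ρ` with `|Re tr ρ| ≤ M`, continuous `φ : G → ℝ` with `|φ| ≤ C`, a plaquette `p`,
EVERY `β ∈ ℝ` and EVERY `ν ∈ 𝒢(β)`:
`|∫ φ(U_p) dν − ∫ φ dHaar − β · Cov_Haar(φ, Re tr ρ)| ≤ 6 C ((N + M) · #plaquettesTouching(edges p))² · β²`.
Proof: the DLR equation at the four links of `p` writes `∫ φ(U_p) dν` as the `ν`-average over boundary conditions `η` of the
tilted kernel expectation; item 1 expands each kernel to second order around `β = 0` with an `η`-uniform remainder; by item 2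
the zeroth- and first-order coefficients do not depend on `η`. [folklore] -/
theorem abs_integral_plaquette_sub_taylor_le (hρ : Continuous ρ) {M : ℝ} (hM : ∀ g : G, |(ρ g).trace.re| ≤ M)
    {φ : G → ℝ} (hφ : Continuous φ) {C : ℝ} (hC : ∀ g, |φ g| ≤ C) (p : ZdPlaquette d) (β : ℝ)
    {ν : Measure (LGConfig d G)} (hν : ν ∈ ymGibbsMeasures (d := d) ρ β) :
    |(∫ U, φ (plaquetteHolonomyZd U p.1 p.2.1.1 p.2.1.2) ∂ν) - (∫ g, φ g ∂haarProbability G) -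
        β * ((∫ g, φ g * reTr ρ g ∂haarProbability G) -
          (∫ g, φ g ∂haarProbability G) * ∫ g, reTr ρ g ∂haarProbability G)| ≤
      6 * C * (((N : ℝ) + M) * (plaquettesTouching (plaquetteEdges p)).card) ^ 2 * β ^ 2 := by
  classical
  set Λ : Finset (ZdEdge d) := plaquetteEdges p with hΛ
  set F : LGConfig d G → ℝ := fun U => φ (plaquetteHolonomyZd U p.1 p.2.1.1 p.2.1.2) with hF
  set c : ℝ := ∫ g, φ g ∂haarProbability G with hc
  set X : ℝ := (∫ g, φ g * reTr ρ g ∂haarProbability G) -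
    (∫ g, φ g ∂haarProbability G) * ∫ g, reTr ρ g ∂haarProbability G with hX
  set K : ℝ := 6 * C * (((N : ℝ) + M) * (plaquettesTouching Λ).card) ^ 2 with hK
  have hFc : Continuous F := hφ.comp (AreaLaw.continuous_plaquette p.1 p.2.1.1 p.2.1.2)
  have hFm : Measurable F := hFc.measurable
  have hFC : ∀ U, |F U| ≤ C := fun U => hC _
  have hWm : Measurable (wilsonBoundaryAction (G := G) ρ Λ) := (continuous_wilsonBoundaryAction ρ hρ Λ).measurable
  have hWB : ∀ U : LGConfig d G, |wilsonBoundaryAction ρ Λ U| ≤ ((N : ℝ) + M) * (plaquettesTouching Λ).card :=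
    fun U => abs_wilsonBoundaryAction_le_card ρ hM Λ U
  -- the kernel expectation as a function of the boundary condition, and its `η`-uniform expansion
  have hker : ∀ η : LGConfig d G,
      |(∫ U, F U ∂(ymSpecification ρ β Λ η)) - (c + β * X)| ≤ K * β ^ 2 := by
    intro η
    haveI : IsProbabilityMeasure (((Measure.pi fun _ : ↥Λ => haarProbability G).map (glueWith Λ · η))) :=
      isProbabilityMeasure_pi_glueWith Λ η
    have h := abs_integral_tilted_taylor_two_le
      (P := (Measure.pi fun _ : ↥Λ => haarProbability G).map (glueWith Λ · η)) hFm hFC hWm hWB β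
    have h0 : ∫ U, F U ∂((Measure.pi fun _ : ↥Λ => haarProbability G).map (glueWith Λ · η)) = c :=
      integral_comp_holonomy_pi_glueWith hφ p η
    have h1 : (∫ U, F U * wilsonBoundaryAction ρ Λ U ∂((Measure.pi fun _ : ↥Λ => haarProbability G).map
          (glueWith Λ · η))) -
        (∫ U, F U ∂((Measure.pi fun _ : ↥Λ => haarProbability G).map (glueWith Λ · η))) *
          ∫ U, wilsonBoundaryAction ρ Λ U ∂((Measure.pi fun _ : ↥Λ => haarProbability G).map (glueWith Λ · η)) =
        -X :=
      cov_holonomy_wilsonBoundaryAction_pi_glueWith ρ hρ hφ p η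
    rw [h1, h0] at h
    have e : (∫ U, F U ∂(ymSpecification ρ β Λ η)) - (c + β * X) =
        (∫ U, F U ∂(((Measure.pi fun _ : ↥Λ => haarProbability G).map (glueWith Λ · η)).tilted
          fun U => -β * wilsonBoundaryAction ρ Λ U)) - c + β * -X := by
      rw [show ymSpecification ρ β Λ η = (((Measure.pi fun _ : ↥Λ => haarProbability G).map
        (glueWith Λ · η)).tilted fun U => -β * wilsonBoundaryAction ρ Λ U) from rfl]
      ring
    rw [e]
    exact h
  -- DLR: `ν(F)` is the `ν`-average of the kernel expectations
  have hγ : IsSpecification (ymSpecification (d := d) ρ β) := isSpecification_ymSpecification_of_t2Space ρ hρ β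
  have hνG : IsGibbsMeasure (ymSpecification (d := d) ρ β) ν := hν
  haveI : IsProbabilityMeasure ν := hνG.isProbabilityMeasure
  have hDLR : ∫ η, (∫ U, F U ∂(ymSpecification ρ β Λ η)) ∂ν = ∫ U, F U ∂ν := by
    have h := hνG.setIntegral_integral_spec hγ Λ (B := Set.univ) MeasurableSet.univ hFm hFC
    simpa only [Measure.restrict_univ] using h
  -- integrate the kernel expansion against `ν`
  have hint : Integrable (fun η => ∫ U, F U ∂(ymSpecification ρ β Λ η)) ν :=
    Literature.MathematicalPhysics.QuantumLattice.integrable_of_bound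
      (Literature.MathematicalPhysics.QuantumLattice.continuous_integral_ymSpecification ρ hρ β Λ hFc
        hFC).aestronglyMeasurable
      (Literature.MathematicalPhysics.QuantumLattice.abs_integral_ymSpecification_le ρ hρ β Λ hFC)
  have hsplit : (∫ U, F U ∂ν) - c - β * X = ∫ η, ((∫ U, F U ∂(ymSpecification ρ β Λ η)) - (c + β * X)) ∂ν := by
    rw [integral_sub hint (integrable_const _), integral_const, probReal_univ, one_smul, hDLR]
    ring
  rw [hsplit]
  have h := norm_integral_le_of_norm_le_const (μ := ν) (C := K * β ^ 2)
    (f := fun η => (∫ U, F U ∂(ymSpecification ρ β Λ η)) - (c + β * X))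
    (ae_of_all _ fun η => by simpa only [Real.norm_eq_abs] using hker η)
  rw [probReal_univ, mul_one] at h
  simpa only [Real.norm_eq_abs] using h

/-- ★★ **Uniform first-order expansion, constant-free form**: for continuous `ρ`, continuous `φ` and a plaquette `p` there is
`K` such that for EVERY `β ∈ ℝ` and EVERY DLR state `ν ∈ 𝒢(β)`,
`|∫ φ(U_p) dν − ∫ φ dHaar − β · Cov_Haar(φ, Re tr ρ)| ≤ K β²` — the first strong-coupling coefficient of every
single-plaquette observable is `Cov_Haar(φ, Re tr ρ)`, for every compact gauge group, with no uniqueness, window or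
cluster-expansion hypothesis. [folklore] -/
theorem exists_forall_abs_integral_plaquette_sub_le (hρ : Continuous ρ) {φ : G → ℝ} (hφ : Continuous φ)
    (p : ZdPlaquette d) :
    ∃ K : ℝ, ∀ (β : ℝ) (ν : Measure (LGConfig d G)), ν ∈ ymGibbsMeasures (d := d) ρ β →
      |(∫ U, φ (plaquetteHolonomyZd U p.1 p.2.1.1 p.2.1.2) ∂ν) - (∫ g, φ g ∂haarProbability G) -
          β * ((∫ g, φ g * reTr ρ g ∂haarProbability G) -
            (∫ g, φ g ∂haarProbability G) * ∫ g, reTr ρ g ∂haarProbability G)| ≤ K * β ^ 2 := by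
  obtain ⟨M, -, hM⟩ := exists_bound_trace_re_nonneg ρ hρ
  obtain ⟨C, hC⟩ := Literature.MathematicalPhysics.QuantumLattice.exists_bound_of_continuous hφ
  exact ⟨_, fun β ν hν => abs_integral_plaquette_sub_taylor_le ρ hρ hM hφ hC p β hν⟩

/-- **At `β = 0` every DLR state gives every single-plaquette observable its Haar mean** (the expansion at `β = 0`).
[folklore] -/
theorem integral_plaquette_eq_of_mem_zero (hρ : Continuous ρ) {φ : G → ℝ} (hφ : Continuous φ) (p : ZdPlaquette d)
    {ν : Measure (LGConfig d G)} (hν : ν ∈ ymGibbsMeasures (d := d) ρ 0) :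
    ∫ U, φ (plaquetteHolonomyZd U p.1 p.2.1.1 p.2.1.2) ∂ν = ∫ g, φ g ∂haarProbability G := by
  obtain ⟨K, hK⟩ := exists_forall_abs_integral_plaquette_sub_le ρ hρ hφ p
  have h := hK 0 ν hν
  simp only [zero_mul, sub_zero, ne_eq, OfNat.ofNat_ne_zero, not_false_eq_true, zero_pow, mul_zero,
    abs_nonpos_iff, sub_eq_zero] at h
  exact h

/-- **First-order selection rule**: an observable Haar-uncorrelated with `Re tr ρ` (e.g. a character of an irreducible
representation not contained in `ρ ⊕ ρ̄`) has NO first-order response: `|∫ φ(U_p) dν − ∫ φ dHaar| ≤ K β²` uniformly over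
`ν ∈ 𝒢(β)`. [folklore] -/
theorem exists_forall_abs_integral_plaquette_sub_le_of_cov_eq_zero (hρ : Continuous ρ) {φ : G → ℝ} (hφ : Continuous φ)
    (hcov : (∫ g, φ g * reTr ρ g ∂haarProbability G) =
      (∫ g, φ g ∂haarProbability G) * ∫ g, reTr ρ g ∂haarProbability G) (p : ZdPlaquette d) :
    ∃ K : ℝ, ∀ (β : ℝ) (ν : Measure (LGConfig d G)), ν ∈ ymGibbsMeasures (d := d) ρ β →
      |(∫ U, φ (plaquetteHolonomyZd U p.1 p.2.1.1 p.2.1.2) ∂ν) - (∫ g, φ g ∂haarProbability G)| ≤ K * β ^ 2 := by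
  obtain ⟨K, hK⟩ := exists_forall_abs_integral_plaquette_sub_le ρ hρ hφ p
  refine ⟨K, fun β ν hν => ?_⟩
  have h := hK β ν hν
  rwa [hcov, sub_self, mul_zero, sub_zero] at h

/-! ## 4. Derivatives at `β = 0` along any DLR family -/

/-- ★ **Along ANY family of DLR states `β ↦ ν_β ∈ 𝒢(β)` (near `0`), the expectation of a single-plaquette observable is
differentiable at `β = 0` with derivative `Cov_Haar(φ, Re tr ρ)`** — every compact gauge group, no uniqueness or continuity
hypothesis on the family (the `O(β²)` remainder is uniform). [folklore] -/
theorem hasDerivAt_integral_plaquette_zero (hρ : Continuous ρ) {φ : G → ℝ} (hφ : Continuous φ) (p : ZdPlaquette d)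
    {ν : ℝ → Measure (LGConfig d G)} (hν : ∀ᶠ β in 𝓝 0, ν β ∈ ymGibbsMeasures (d := d) ρ β) :
    HasDerivAt (fun β => ∫ U, φ (plaquetteHolonomyZd U p.1 p.2.1.1 p.2.1.2) ∂(ν β))
      ((∫ g, φ g * reTr ρ g ∂haarProbability G) -
        (∫ g, φ g ∂haarProbability G) * ∫ g, reTr ρ g ∂haarProbability G) 0 := by
  obtain ⟨K, hK⟩ := exists_forall_abs_integral_plaquette_sub_le ρ hρ hφ p
  set D : ℝ := (∫ g, φ g * reTr ρ g ∂haarProbability G) -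
    (∫ g, φ g ∂haarProbability G) * ∫ g, reTr ρ g ∂haarProbability G with hD
  have h0 : ∫ U, φ (plaquetteHolonomyZd U p.1 p.2.1.1 p.2.1.2) ∂(ν 0) = ∫ g, φ g ∂haarProbability G :=
    integral_plaquette_eq_of_mem_zero ρ hρ hφ p hν.self_of_nhds
  rw [hasDerivAt_iff_isLittleO]
  simp only [sub_zero, h0]
  have h1 : (fun β => (∫ U, φ (plaquetteHolonomyZd U p.1 p.2.1.1 p.2.1.2) ∂(ν β)) -
      (∫ g, φ g ∂haarProbability G) - β • D) =O[𝓝 0] fun β => β ^ 2 := by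
    refine Asymptotics.IsBigO.of_bound K ?_
    filter_upwards [hν] with β hβ
    rw [Real.norm_eq_abs, Real.norm_eq_abs, abs_pow, sq_abs, smul_eq_mul]
    exact hK β (ν β) hβ
  exact h1.trans_isLittleO (Asymptotics.isLittleO_pow_id one_lt_two)

/-- ★ **The slope of the mean plaquette at `β = 0` is the Haar VARIANCE of `Re tr ρ`** — along any family of DLR states,
every compact gauge group (for `SU(2)`, `d = 4` this is the Balian–Drouffe–Itzykson coefficient `u'(0⁺) = 1/4` in Wilson's
normalisation `⟨½ Re tr U_p⟩`, `β_W = 2β`, of gen 9's `su2_hasDerivWithinAt_plaquette_zero`, now two-sided and for every `G`).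
[folklore] -/
theorem hasDerivAt_plaquetteObs_zero (hρ : Continuous ρ) (p : ZdPlaquette d) {ν : ℝ → Measure (LGConfig d G)}
    (hν : ∀ᶠ β in 𝓝 0, ν β ∈ ymGibbsMeasures (d := d) ρ β) :
    HasDerivAt (fun β => ∫ U, plaquetteObs ρ p.1 p.2.1.1 p.2.1.2 U ∂(ν β))
      ((∫ g, reTr ρ g ^ 2 ∂haarProbability G) - (∫ g, reTr ρ g ∂haarProbability G) ^ 2) 0 := by
  have h := hasDerivAt_integral_plaquette_zero ρ hρ (continuous_reTr ρ hρ) p hν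
  simp only [← sq] at h
  exact h

omit [SecondCountableTopology G] [T2Space G] in
/-- The Haar variance of `Re tr ρ` — the slope of the mean plaquette at `β = 0` — is non-negative (it is
`∫ (Re tr ρ − m)² dHaar`, `m` the Haar mean). [folklore] -/
theorem integral_reTr_sq_sub_sq_nonneg (hρ : Continuous ρ) :
    0 ≤ (∫ g, reTr ρ g ^ 2 ∂haarProbability G) - (∫ g, reTr ρ g ∂haarProbability G) ^ 2 := by
  set m : ℝ := ∫ g, reTr ρ g ∂haarProbability G with hm
  have hr : Continuous (reTr ρ) := continuous_reTr ρ hρ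
  have hint1 : Integrable (reTr ρ) (haarProbability G) :=
    hr.integrable_of_hasCompactSupport (HasCompactSupport.of_compactSpace _)
  have hint2 : Integrable (fun g => reTr ρ g ^ 2) (haarProbability G) :=
    (hr.pow 2).integrable_of_hasCompactSupport (HasCompactSupport.of_compactSpace _)
  have h : ∫ g, (reTr ρ g - m) ^ 2 ∂haarProbability G = (∫ g, reTr ρ g ^ 2 ∂haarProbability G) - m ^ 2 := by
    have e : ∀ g, (reTr ρ g - m) ^ 2 = (reTr ρ g ^ 2 - 2 * m * reTr ρ g) + m ^ 2 := fun g => by ring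
    simp_rw [e]
    have hB : Integrable (fun g => 2 * m * reTr ρ g) (haarProbability G) := hint1.const_mul _
    have hA : Integrable (fun g => reTr ρ g ^ 2 - 2 * m * reTr ρ g) (haarProbability G) := hint2.sub hB
    rw [integral_add hA (integrable_const _), integral_sub hint2 hB, integral_const_mul, integral_const, probReal_univ,
      one_smul, ← hm]
    ring
  rw [← h]
  exact integral_nonneg fun g => sq_nonneg _

end Expansion


/-! ## 5. The second-order jet of the free energy density at `β = 0`, every compact gauge group -/

section Pressure

-- `G : Type` (universe `0`), as in gen 9's `PressureRegularity.hasDerivAt_freeEnergyDensity`, which is applied below.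
variable {d N : ℕ} {G : Type} [Group G] [TopologicalSpace G] [IsTopologicalGroup G] [CompactSpace G]
  [MeasurableSpace G] [BorelSpace G] [SecondCountableTopology G] [T2Space G] (ρ : G →* Matrix (Fin N) (Fin N) ℂ)

/-- Local shorthand: the coordinate planes `{(i, j) : i < j}` of `ℤ^d`. -/
local notation3 (prettyPrint := false) "𝔓" d => {q : Fin d × Fin d // q.1 < q.2}

/-- **`f'(β) = −e(ν_β)` near `β = 0` along gen 13's analytic torus-limit DLR selection, every compact gauge group** — the
working form used below (gen 9's energy-subgradient chord `PressureRegularity.hasDerivAt_freeEnergyDensity`; translation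
invariance of torus limit points; continuity of the plaquette expectations from their analyticity). [folklore] -/
theorem exists_selection_hasDerivAt_freeEnergyDensity (hρ : Continuous ρ) :
    ∃ ν : ℝ → Measure (LGConfig d G),
      (∀ β : ℝ, |β| < betaOne d ρ / 4 → ν β ∈ ymGibbsMeasures (d := d) ρ β) ∧
      ∀ β : ℝ, |β| < betaOne d ρ / 4 →
        HasDerivAt (freeEnergyDensity d ρ)
          (-∑ q : 𝔓 d, ((N : ℝ) - ∫ U, plaquetteObs ρ 0 q.1.1 q.1.2 U ∂(ν β))) β := by
  obtain ⟨ν, hν, han⟩ := StrongCouplingAnalytic.exists_analytic_dlr_selection (d := d) ρ hρ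
  refine ⟨ν, fun β hβ => (hν β hβ).1, fun β hβ => ?_⟩
  have hβ' : β ∈ Ioo (-(betaOne d ρ / 4)) (betaOne d ρ / 4) := ⟨(abs_lt.1 hβ).1, (abs_lt.1 hβ).2⟩
  obtain ⟨M, -, hM⟩ := exists_bound_trace_re_nonneg ρ hρ
  refine PressureRegularity.hasDerivAt_freeEnergyDensity ρ hρ (S := Ioo (-(betaOne d ρ / 4)) (betaOne d ρ / 4))
    (μ := ν) (fun b hb => (hν b (abs_lt.2 ⟨hb.1, hb.2⟩)).1)
    (fun b hb => Literature.MathematicalPhysics.QuantumLattice.isZdTranslationInvariant_of_mem_infiniteVolumeLimitPoints ρ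
      (hν b (abs_lt.2 ⟨hb.1, hb.2⟩)).2.mem_infiniteVolumeLimitPoints)
    (isOpen_Ioo.mem_nhds hβ') fun q => ?_
  have hbd : ∃ C, ∀ U : LGConfig d G, |plaquetteObs ρ 0 q.1.1 q.1.2 U| ≤ C :=
    ⟨M, fun U => hM (plaquetteHolonomyZd U 0 q.1.1 q.1.2)⟩
  exact (han (plaquetteObs ρ 0 q.1.1 q.1.2) _
    (Literature.MathematicalPhysics.QuantumLattice.isCylinder_plaquetteObs_zero ρ q.1.1 q.1.2)
    (continuous_plaquetteObs ρ hρ 0 _ _) hbd β hβ').continuousAt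

/-- ★★ **`f'(0) = −#planes · (N − ∫ Re tr ρ dHaar)`, every compact gauge group, every `d`** — the two-sided first
derivative of the free energy density at `β = 0` (`#planes = d(d−1)/2`; for `SU(N)`, `N ≥ 2`, the Haar mean vanishes and
`f'(0) = −N d(d−1)/2`, e.g. `−12` for `SU(2)`, `d = 4`). [folklore] -/
theorem hasDerivAt_freeEnergyDensity_zero (hρ : Continuous ρ) :
    HasDerivAt (freeEnergyDensity d ρ)
      (-((Fintype.card (𝔓 d) : ℝ) * ((N : ℝ) - ∫ g, reTr ρ g ∂haarProbability G))) 0 := by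
  obtain ⟨ν, hν, hd⟩ := exists_selection_hasDerivAt_freeEnergyDensity (d := d) ρ hρ
  have hβ0 : |(0 : ℝ)| < betaOne d ρ / 4 := by
    rw [abs_zero]; exact div_pos (betaOne_pos (ρ := ρ) d) (by norm_num)
  have h := hd 0 hβ0
  have hplaq : ∀ q : 𝔓 d, ∫ U, plaquetteObs ρ 0 q.1.1 q.1.2 U ∂(ν 0) = ∫ g, reTr ρ g ∂haarProbability G := fun q =>
    integral_plaquette_eq_of_mem_zero ρ hρ (continuous_reTr ρ hρ) ((0 : Literature.Probability.LatticeModels.Site d), q)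
      (hν 0 hβ0)
  simp only [hplaq, Finset.sum_const, Finset.card_univ, nsmul_eq_mul] at h
  exact h

/-- **`deriv` form of `f'(0)`.** [folklore] -/
theorem deriv_freeEnergyDensity_zero (hρ : Continuous ρ) :
    deriv (freeEnergyDensity d ρ) 0 = -((Fintype.card (𝔓 d) : ℝ) * ((N : ℝ) - ∫ g, reTr ρ g ∂haarProbability G)) :=
  (hasDerivAt_freeEnergyDensity_zero ρ hρ).deriv

/-- ★★ **`f''(0) = #planes · Var_Haar(Re tr ρ)`, EVERY compact gauge group, every `d`** — the two-sided second derivative of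
the free energy density at `β = 0` exists and equals the number of coordinate planes times the Haar variance of the plaquette
action: `f' = −e(ν_β)` near `0` along the analytic torus-limit selection, and each plane's plaquette expectation has slope
`Var_Haar(Re tr ρ)` at `0` by the uniform first-order expansion. The leading Balian–Drouffe–Itzykson coefficient of the
specific heat, for every gauge group. [folklore] -/
theorem hasDerivAt_deriv_freeEnergyDensity_zero (hρ : Continuous ρ) :
    HasDerivAt (deriv (freeEnergyDensity d ρ))
      ((Fintype.card (𝔓 d) : ℝ) *
        ((∫ g, reTr ρ g ^ 2 ∂haarProbability G) - (∫ g, reTr ρ g ∂haarProbability G) ^ 2)) 0 := by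
  obtain ⟨ν, hν, hd⟩ := exists_selection_hasDerivAt_freeEnergyDensity (d := d) ρ hρ
  have hβ0 : 0 < betaOne d ρ / 4 := div_pos (betaOne_pos (ρ := ρ) d) (by norm_num)
  have hnhds : Ioo (-(betaOne d ρ / 4)) (betaOne d ρ / 4) ∈ 𝓝 (0 : ℝ) :=
    isOpen_Ioo.mem_nhds ⟨by linarith, hβ0⟩
  -- `deriv f` agrees near `0` with the energy expression along the selection
  have heq : deriv (freeEnergyDensity d ρ) =ᶠ[𝓝 0]
      fun β => -∑ q : 𝔓 d, ((N : ℝ) - ∫ U, plaquetteObs ρ 0 q.1.1 q.1.2 U ∂(ν β)) := by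
    filter_upwards [hnhds] with β hβ
    exact (hd β (abs_lt.2 ⟨hβ.1, hβ.2⟩)).deriv
  -- each plane's plaquette expectation has slope `Var` at `0`
  have hνev : ∀ᶠ β in 𝓝 0, ν β ∈ ymGibbsMeasures (d := d) ρ β := by
    filter_upwards [hnhds] with β hβ
    exact hν β (abs_lt.2 ⟨hβ.1, hβ.2⟩)
  have hq : ∀ q : 𝔓 d, HasDerivAt (fun β => ∫ U, plaquetteObs ρ 0 q.1.1 q.1.2 U ∂(ν β))
      ((∫ g, reTr ρ g ^ 2 ∂haarProbability G) - (∫ g, reTr ρ g ∂haarProbability G) ^ 2) 0 := fun q =>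
    hasDerivAt_plaquetteObs_zero ρ hρ ((0 : Literature.Probability.LatticeModels.Site d), q) hνev
  have hsum : HasDerivAt (fun β => ∑ q : 𝔓 d, ((N : ℝ) - ∫ U, plaquetteObs ρ 0 q.1.1 q.1.2 U ∂(ν β)))
      (∑ q : 𝔓 d, (0 - ((∫ g, reTr ρ g ^ 2 ∂haarProbability G) - (∫ g, reTr ρ g ∂haarProbability G) ^ 2))) 0 :=
    HasDerivAt.fun_sum (u := Finset.univ)
      (A := fun (q : 𝔓 d) (β : ℝ) => (N : ℝ) - ∫ U, plaquetteObs ρ 0 q.1.1 q.1.2 U ∂(ν β))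
      fun q _ => (hasDerivAt_const (0 : ℝ) (N : ℝ)).sub (hq q)
  have hneg := hsum.neg
  simp only [zero_sub, Finset.sum_neg_distrib, neg_neg, Finset.sum_const, Finset.card_univ, nsmul_eq_mul] at hneg
  exact hneg.congr_of_eventuallyEq heq

/-- **`deriv` form of `f''(0)`**: `deriv (deriv f) 0 = #planes · Var_Haar(Re tr ρ)`, every compact gauge group. [folklore] -/
theorem deriv_deriv_freeEnergyDensity_zero (hρ : Continuous ρ) :
    deriv (deriv (freeEnergyDensity d ρ)) 0 =
      (Fintype.card (𝔓 d) : ℝ) * ((∫ g, reTr ρ g ^ 2 ∂haarProbability G) - (∫ g, reTr ρ g ∂haarProbability G) ^ 2) :=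
  (hasDerivAt_deriv_freeEnergyDensity_zero ρ hρ).deriv

/-- `f''(0) ≥ 0` (convexity seen at the endpoint: the coefficient is a variance). [folklore] -/
theorem deriv_deriv_freeEnergyDensity_zero_nonneg (hρ : Continuous ρ) : 0 ≤ deriv (deriv (freeEnergyDensity d ρ)) 0 := by
  rw [deriv_deriv_freeEnergyDensity_zero ρ hρ]
  exact mul_nonneg (Nat.cast_nonneg _) (integral_reTr_sq_sub_sq_nonneg ρ hρ)

/-! ## 6. Rows: `G ≅ SU(N)` in the fundamental representation -/

/-- **`SU(N)`, `N ≥ 2`: the slope of the mean plaquette `⟨Re tr U_p⟩` at `β = 0` is `charVariance ρ`** (`= 1` for `SU(2)`,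
`= 1/2` for `N ≥ 3`, rb-p2's `HaarSecondMoments`) along any family of DLR states — every `d`, two-sided. [folklore] -/
theorem hasDerivAt_plaquetteObs_zero_SU (hρ : IsSpecialUnitaryModel ρ) (hN : 2 ≤ N) (p : ZdPlaquette d)
    {ν : ℝ → Measure (LGConfig d G)} (hν : ∀ᶠ β in 𝓝 0, ν β ∈ ymGibbsMeasures (d := d) ρ β) :
    HasDerivAt (fun β => ∫ U, plaquetteObs ρ p.1 p.2.1.1 p.2.1.2 U ∂(ν β)) (charVariance ρ) 0 := by
  have h := hasDerivAt_plaquetteObs_zero ρ hρ.1 p hν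
  rwa [integral_reTr_eq_zero ρ hρ hN, zero_pow two_ne_zero, sub_zero] at h

/-- ★ **`SU(N)`, `N ≥ 2`, every `d`: `f'(0) = −N · #planes` and `f''(0) = #planes · charVariance ρ`.** [folklore] -/
theorem deriv_deriv_freeEnergyDensity_zero_SU (hρ : IsSpecialUnitaryModel ρ) (hN : 2 ≤ N) :
    deriv (freeEnergyDensity d ρ) 0 = -((Fintype.card (𝔓 d) : ℝ) * N) ∧
      deriv (deriv (freeEnergyDensity d ρ)) 0 = (Fintype.card (𝔓 d) : ℝ) * charVariance ρ := by
  refine ⟨?_, ?_⟩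
  · rw [deriv_freeEnergyDensity_zero ρ hρ.1, integral_reTr_eq_zero ρ hρ hN, sub_zero]
  · rw [deriv_deriv_freeEnergyDensity_zero ρ hρ.1, integral_reTr_eq_zero ρ hρ hN, zero_pow two_ne_zero, sub_zero]
    rfl

/-- ★ **`SU(2)`, `d = 4`: `f''(0) = 6`** (`= #planes · charVariance = 6 · 1`) — the tree's gen-9 two-sided value
(`PressureRegularity.su2_hasDerivAt_deriv_freeEnergyDensity_zero`, obtained there from the `SU(2)` sign flip and the window
machinery), re-derived from the every-`G` theorem; and `f'(0) = −12`. [folklore] -/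
theorem su2_deriv_deriv_freeEnergyDensity_zero :
    deriv (freeEnergyDensity 4 (fundamentalRep (Fin 2))) 0 = -12 ∧
      deriv (deriv (freeEnergyDensity 4 (fundamentalRep (Fin 2)))) 0 = 6 := by
  haveI : SecondCountableTopology (Matrix.specialUnitaryGroup (Fin 2) ℂ) :=
    haveI : SecondCountableTopology (Matrix (Fin 2) (Fin 2) ℂ) :=
      inferInstanceAs (SecondCountableTopology (Fin 2 → Fin 2 → ℂ))
    Topology.IsEmbedding.subtypeVal.secondCountableTopology
  have h := deriv_deriv_freeEnergyDensity_zero_SU (d := 4) (fundamentalRep (Fin 2))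
    (TorusAreaLaw.isSpecialUnitaryModel_fundamentalRep 2) le_rfl
  have hcard : (Fintype.card (𝔓 4) : ℝ) = 6 := by
    rw [Fintype.card_subtype]; norm_cast
  rw [hcard, RobustBall.HaarSecondMoments.charVariance_su2] at h
  norm_num at h
  exact h

/-- ★ **`SU(N)`, `N ≥ 3`, `d = 4`: `f'(0) = −6N` and `f''(0) = 3`** (`= 6 · 1/2`; e.g. `SU(3)`: `f'(0) = −18`, `f''(0) = 3`).
[folklore] -/
theorem suN_deriv_deriv_freeEnergyDensity_zero {N : ℕ} (hN : 3 ≤ N) :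
    deriv (freeEnergyDensity 4 (fundamentalRep (Fin N))) 0 = -(6 * N) ∧
      deriv (deriv (freeEnergyDensity 4 (fundamentalRep (Fin N)))) 0 = 3 := by
  haveI : SecondCountableTopology (Matrix.specialUnitaryGroup (Fin N) ℂ) :=
    haveI : SecondCountableTopology (Matrix (Fin N) (Fin N) ℂ) :=
      inferInstanceAs (SecondCountableTopology (Fin N → Fin N → ℂ))
    Topology.IsEmbedding.subtypeVal.secondCountableTopology
  have h := deriv_deriv_freeEnergyDensity_zero_SU (d := 4) (fundamentalRep (Fin N))
    (TorusAreaLaw.isSpecialUnitaryModel_fundamentalRep N) (by omega)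
  have hcard : (Fintype.card (𝔓 4) : ℝ) = 6 := by
    rw [Fintype.card_subtype]; norm_cast
  rw [hcard, RobustBall.HaarSecondMoments.charVariance_suN hN] at h
  norm_num at h
  exact h

end Pressure

end Summit.Ventures.YMGap.ZeroCouplingSlope
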